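import Mathlib
import Summits.NavierStokesRegularity.NavierStokesRegularity.Theorems.WakeRatchetTailRatchetScalarFrontLimitCC
import Summits.NavierStokesRegularity.NavierStokesRegularity.Theorems.WakeRatchetExtractionAscoli
import HarnessLib

/-!
# Scalar dyadic fronts (the construction `DyadicScalarFronts` of stmt-NavierStokesRegularity-21808):
# CLOSEDNESS of the front set — Arzelà–Ascoli extraction in log-time and the limit witness

The construction item `WakeRatchetDyadicFront.DyadicScalarFronts` (modulo which the crux
`WakeRatchet.TailRatchet` is refuted) is PROVED at every large base
(`WakeRatchetLacunaryFront.dyadicScalarFronts_all_large`) and open at small `ε₀`.  The natural door from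
large to small base is a continuation in the base; this file proves its CLOSEDNESS half in the form a
continuation or degree argument consumes (companions: `…ScalarFrontCompactness`, `…ScalarFrontLimitCC`):

* `lipschitz_of_deriv_bound` — a derivative bound on `(−∞,0)` is a Lipschitz bound there.
* `exists_frontLimit_cc` — EXTRACTION: a family `a_j` with `|a_j| ≤ P` and `|a_j'| ≤ C` on `(−∞,0)`
  (for `j ≥ J`) has a subsequence converging continuously on `(−∞,0)` to a function continuous there
  (the tree's abstract Arzelà–Ascoli `exists_subseq_continuousLimit` of file `WakeRatchetExtractionAscoli`,
  in the log-time variable `x = −log(−t)`, where the derivative bound is an equi-Lipschitz bound on every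
  half-line; the limit is locally Lipschitz).
* `exists_dyadicScalarFront_of_limit` — CLOSEDNESS: fronts with parameters `(Λ_j, s_j) → (bigLam ε₀, s)`,
  `s > 0`, uniformly bounded (sup `P`, mass `𝓜`) with a common floor `a_j(t⋆) ≥ lo > 0`, yield a function
  satisfying the four clauses of `DyadicScalarFronts` at `(ε₀, s)`.

What a continuation from the lacunary regime down to small `ε₀` still needs: the a-priori bounds along
the branch (sup after scaling normalisation, mass, floor, `1 < s < Λ`; partly in the tree's a-priori theory
of fronts) and the OPENNESS half (Fredholm / transversality of the linearised mixed-type functional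
equation, or a Leray–Schauder degree); neither is addressed here.

HONEST FRAMING: elementary real analysis about a MODEL lattice ODE (Tao 2016 §1.2, §4); nothing here
concerns the Navier–Stokes equations; no item is closed; `DyadicScalarFronts` at small `ε₀` stays open.
-/

noncomputable section

set_option linter.dupNamespace false

namespace Summit.NavierStokesRegularity.NavierStokesRegularity.Theorems

namespace WakeRatchetScalarFrontCompactness

open Set Filter Topology MeasureTheory intervalIntegral
open Literature.Analysis.FluidPDE Literature.Analysis.FluidPDE.TaoCascade

/-! ## Arzelà–Ascoli extraction for families of fronts -/

/-- **A derivative bound on `(−∞, 0)` is a Lipschitz bound there.** [folklore] -/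
theorem lipschitz_of_deriv_bound {f f' : ℝ → ℝ} {C : ℝ}
    (hf : ∀ t : ℝ, t < 0 → HasDerivAt f (f' t) t) (hC : ∀ t : ℝ, t < 0 → |f' t| ≤ C) :
    ∀ u v : ℝ, u < 0 → v < 0 → |f u - f v| ≤ C * |u - v| := by
  intro u v hu hv
  have h := (convex_Iio (0 : ℝ)).norm_image_sub_le_of_norm_hasDerivWithin_le
    (fun t (ht : t < 0) => (hf t ht).hasDerivWithinAt)
    (fun t (ht : t < 0) => by rw [Real.norm_eq_abs]; exact hC t ht) hv hu
  rwa [Real.norm_eq_abs, Real.norm_eq_abs] at h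

/-- **EXTRACTION.**  A family `a_j : ℝ → ℝ`, differentiable on `(−∞, 0)` with `|a_j| ≤ P` and
`|a_j'| ≤ C` there for all `j ≥ J`, has a subsequence converging CONTINUOUSLY on `(−∞, 0)`
(`u_j → σ < 0 ⇒ a_{φ j}(u_j) → a(σ)`) to a function `a` continuous on `(−∞, 0)`.  (The tree's abstract
Arzelà–Ascoli `…MinimalBlowupExtraction.Extraction.exists_subseq_continuousLimit` (file `WakeRatchetExtractionAscoli`) in the log-time variable
`x = −log(−t)`, in which the derivative bound becomes an equi-Lipschitz bound on every half-line.)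
[folklore] -/
theorem exists_frontLimit_cc {a a' : ℕ → ℝ → ℝ} {P C : ℝ} {J : ℕ}
    (hder : ∀ j, J ≤ j → ∀ t : ℝ, t < 0 → HasDerivAt (a j) (a' j t) t)
    (hbd : ∀ j, J ≤ j → ∀ t : ℝ, t < 0 → |a j t| ≤ P)
    (hC : ∀ j, J ≤ j → ∀ t : ℝ, t < 0 → |a' j t| ≤ C) :
    ∃ φ : ℕ → ℕ, StrictMono φ ∧ ∃ alim : ℝ → ℝ, ContinuousOn alim (Iio 0) ∧
      ∀ (u : ℕ → ℝ) (σ : ℝ), σ < 0 → Tendsto u atTop (𝓝 σ) →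
        Tendsto (fun j => a (φ j) (u j)) atTop (𝓝 (alim σ)) := by
  have hneg : ∀ x : ℝ, -Real.exp (-x) < 0 := fun x => neg_neg_of_pos (Real.exp_pos _)
  have hC0 : 0 ≤ C := (abs_nonneg _).trans (hC J le_rfl _ (hneg 0))
  -- `x ↦ e^{-x}` is `e^{-a₀}`-Lipschitz on `[a₀, ∞)` (tree: `PoloidalLiouville.NetFlux.abs_exp_neg_sub_le`)
  have abs_exp_neg_sub_le : ∀ {a₀ u v : ℝ}, a₀ ≤ u → a₀ ≤ v →
      |Real.exp (-u) - Real.exp (-v)| ≤ Real.exp (-a₀) * |u - v| := by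
    intro a₀ u v hu hv
    have hd : ∀ x ∈ Ici a₀, HasDerivWithinAt (fun x => Real.exp (-x)) (Real.exp (-x) * -1) (Ici a₀) x :=
      fun x _ => ((Real.hasDerivAt_exp (-x)).comp x (hasDerivAt_neg x)).hasDerivWithinAt
    have hb : ∀ x ∈ Ici a₀, ‖Real.exp (-x) * -1‖ ≤ Real.exp (-a₀) := by
      intro x (hx : a₀ ≤ x)
      rw [mul_neg_one, norm_neg, Real.norm_of_nonneg (Real.exp_pos _).le]
      exact Real.exp_le_exp.2 (by linarith)
    have h := (convex_Ici a₀).norm_image_sub_le_of_norm_hasDerivWithin_le hd hb hv hu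
    rwa [Real.norm_eq_abs, Real.norm_eq_abs] at h
  -- the log-time paths (shell index unused)
  set g : ℕ → ℤ → ℝ → ℝ := fun j _ x => a j (-Real.exp (-x)) with hg
  have hB : ∀ (n : ℤ) (a₀ : ℝ), ∃ C' : ℝ, ∃ J' : ℕ, ∀ j, J' ≤ j → ∀ u : ℝ, a₀ ≤ u → ‖g j n u‖ ≤ C' :=
    fun n a₀ => ⟨P, J, fun j hj u _ => by
      simp only [hg, Real.norm_eq_abs]; exact hbd j hj _ (hneg u)⟩
  have hL : ∀ (n : ℤ) (a₀ : ℝ), ∃ K : ℝ, ∃ J' : ℕ, ∀ j, J' ≤ j → ∀ u v : ℝ, a₀ ≤ u → a₀ ≤ v →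
      ‖g j n u - g j n v‖ ≤ K * |u - v| := by
    intro n a₀
    refine ⟨C * Real.exp (-a₀), J, fun j hj u v hu hv => ?_⟩
    simp only [hg, Real.norm_eq_abs]
    have h1 := lipschitz_of_deriv_bound (hder j hj) (hC j hj) _ _ (hneg u) (hneg v)
    have h2 := abs_exp_neg_sub_le hu hv
    calc |a j (-Real.exp (-u)) - a j (-Real.exp (-v))|
        ≤ C * |(-Real.exp (-u)) - (-Real.exp (-v))| := h1
      _ = C * |Real.exp (-u) - Real.exp (-v)| := by
          rw [show (-Real.exp (-u)) - (-Real.exp (-v)) = -(Real.exp (-u) - Real.exp (-v)) by ring,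
            abs_neg]
      _ ≤ C * (Real.exp (-a₀) * |u - v|) := mul_le_mul_of_nonneg_left h2 hC0
      _ = C * Real.exp (-a₀) * |u - v| := by ring
  obtain ⟨φ, hφ, W, hW⟩ := Summit.NavierStokesRegularity.NavierStokesRegularity.Cruxes.MinimalBlowupExtraction.Extraction.exists_subseq_continuousLimit
      g hB hL
  -- the limit in log-time is locally Lipschitz, hence continuous
  have hφJ : ∀ᶠ j in atTop, J ≤ φ j := (hφ.tendsto_atTop).eventually (eventually_ge_atTop J)
  have hWlip : ∀ a₀ u v : ℝ, a₀ ≤ u → a₀ ≤ v → |W 0 u - W 0 v| ≤ C * Real.exp (-a₀) * |u - v| := by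
    intro a₀ u v hu hv
    have h1 : Tendsto (fun j => |g (φ j) 0 u - g (φ j) 0 v|) atTop (𝓝 |W 0 u - W 0 v|) :=
      (continuous_abs.tendsto _).comp
        ((hW 0 _ u tendsto_const_nhds).sub (hW 0 _ v tendsto_const_nhds))
    refine le_of_tendsto h1 ?_
    filter_upwards [hφJ] with j hj
    have h1 := lipschitz_of_deriv_bound (hder _ hj) (hC _ hj) _ _ (hneg u) (hneg v)
    have h2 := abs_exp_neg_sub_le hu hv
    simp only [hg]
    calc |a (φ j) (-Real.exp (-u)) - a (φ j) (-Real.exp (-v))|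
        ≤ C * |(-Real.exp (-u)) - (-Real.exp (-v))| := h1
      _ = C * |Real.exp (-u) - Real.exp (-v)| := by
          rw [show (-Real.exp (-u)) - (-Real.exp (-v)) = -(Real.exp (-u) - Real.exp (-v)) by ring,
            abs_neg]
      _ ≤ C * (Real.exp (-a₀) * |u - v|) := mul_le_mul_of_nonneg_left h2 hC0
      _ = C * Real.exp (-a₀) * |u - v| := by ring
  have hWcont : Continuous (W 0) := by
    refine continuous_iff_continuousAt.2 fun x₀ => ?_
    have hlip : LipschitzOnWith (Real.toNNReal (C * Real.exp (-(x₀ - 1)))) (W 0) (Ici (x₀ - 1)) := by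
      refine LipschitzOnWith.of_dist_le_mul fun u (hu : x₀ - 1 ≤ u) v (hv : x₀ - 1 ≤ v) => ?_
      rw [Real.dist_eq, Real.dist_eq, Real.coe_toNNReal _ (by positivity)]
      exact hWlip _ u v hu hv
    exact hlip.continuousOn.continuousAt (Ici_mem_nhds (by linarith))
  -- back to physical time
  refine ⟨φ, hφ, fun t => W 0 (-Real.log (-t)), ?_, fun u σ hσ hu => ?_⟩
  · refine hWcont.comp_continuousOn ?_
    refine ((Real.continuousOn_log.comp continuousOn_neg fun t (ht : t < 0) => ?_)).neg
    exact ne_of_gt (neg_pos.2 ht)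
  · have hx : Tendsto (fun j => -Real.log (-u j)) atTop (𝓝 (-Real.log (-σ))) :=
      (((Real.continuousAt_log (ne_of_gt (neg_pos.2 hσ))).tendsto).comp hu.neg).neg
    have h := hW 0 _ _ hx
    refine h.congr' ?_
    filter_upwards [hu.eventually (Iio_mem_nhds hσ)] with j (hj : u j < 0)
    simp only [hg]
    rw [neg_neg, Real.exp_log (neg_pos.2 hj), neg_neg]

/-! ## Closedness of the front set -/

/-- **CLOSEDNESS OF THE SET OF SCALAR DYADIC FRONTS.**  Let `a_j` solve the scalar front equation
with parameters `(Λ_j, s_j)`, `s_j > 0`, `(Λ_j, s_j) → (bigLam ε₀, s)` (`ε₀ > 0`, `s > 0`), and suppose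
the family is uniformly bounded (`|a_j| ≤ P` on `(−∞,0)`), has uniformly bounded mass (`∫_A^b |a_j| ≤ 𝓜`,
`A ≤ b < 0`) and a common floor `a_j(t⋆) ≥ lo > 0`.  Then SOME function `a` satisfies the four clauses of
`WakeRatchetDyadicFront.DyadicScalarFronts` at `(ε₀, s)` (front equation on `t < 0`, integrable on
`(−∞,0)`, bounded near `0⁻`, non-trivial): a subsequence converges (Arzelà–Ascoli in log-time, the
derivative bound coming from the equation) and the limit inherits everything
(`dyadicScalarFront_of_limit_cc`).  With `1 < s` this is a `DyadicScalarFronts`-witness at `ε₀`.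
[cite: Tao2016AveragedNS, §1.2 (dyadic model; DSS front equation in the tree's variables); elementary] -/
theorem exists_dyadicScalarFront_of_limit {a : ℕ → ℝ → ℝ} {Λj sj : ℕ → ℝ}
    {ε₀ s P 𝓜 lo tstar : ℝ} (hε : 0 < ε₀) (hs : 0 < s) (hsj : ∀ j, 0 < sj j)
    (hΛlim : Tendsto Λj atTop (𝓝 (bigLam ε₀))) (hslim : Tendsto sj atTop (𝓝 s))
    (hode : ∀ j, ∀ t : ℝ, t < 0 → HasDerivAt (a j)
      (Λj j / sj j ^ 2 * a j (t / sj j) ^ 2 - sj j / Λj j * a j t * a j (sj j * t)) t)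
    (hbd : ∀ j, ∀ t : ℝ, t < 0 → |a j t| ≤ P)
    (hmass : ∀ j, ∀ A b : ℝ, A ≤ b → b < 0 → ∫ u in A..b, |a j u| ≤ 𝓜)
    (htstar : tstar < 0) (hlo : 0 < lo) (hfloor : ∀ j, lo ≤ a j tstar) :
    ∃ alim : ℝ → ℝ,
      (∀ t : ℝ, t < 0 → HasDerivAt alim
        (bigLam ε₀ / s ^ 2 * alim (t / s) ^ 2 - s / bigLam ε₀ * alim t * alim (s * t)) t) ∧
      IntegrableOn alim (Iio 0) ∧
      (∃ t₀ : ℝ, t₀ < 0 ∧ ∃ P' : ℝ, ∀ t : ℝ, t₀ ≤ t → t < 0 → |alim t| ≤ P') ∧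
      ∃ t : ℝ, t < 0 ∧ alim t ≠ 0 := by
  set Λ : ℝ := bigLam ε₀ with hΛdef
  have hΛ : 0 < Λ := bigLam_pos (by linarith)
  -- eventually the parameters are in the box, so the derivatives are uniformly bounded
  have hevΛ : ∀ᶠ j in atTop, Λ / 2 < Λj j ∧ Λj j < 2 * Λ :=
    (hΛlim.eventually (Ioo_mem_nhds (by linarith) (by linarith))).mono fun j hj => hj
  have hevs : ∀ᶠ j in atTop, s / 2 < sj j ∧ sj j < 2 * s :=
    (hslim.eventually (Ioo_mem_nhds (by linarith) (by linarith))).mono fun j hj => hj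
  obtain ⟨J, hJ⟩ := eventually_atTop.1 (hevΛ.and hevs)
  set C : ℝ := (2 * Λ) / (s / 2) ^ 2 * P ^ 2 + (2 * s) / (Λ / 2) * P ^ 2 with hCdef
  obtain ⟨φ, hφ, alim, hcont, hcc⟩ := exists_frontLimit_cc (J := J)
    (a' := fun j t => Λj j / sj j ^ 2 * a j (t / sj j) ^ 2 - sj j / Λj j * a j t * a j (sj j * t))
    (fun j _ => hode j) (fun j _ => hbd j)
    (fun j hj t ht => frontRHS_abs_le hΛ hs (hJ j hj).1 (hJ j hj).2 (hbd j) ht)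
  refine ⟨alim, dyadicScalarFront_of_limit_cc (a := fun j => a (φ j)) (Λj := fun j => Λj (φ j))
    (sj := fun j => sj (φ j)) hε hs (fun j => hsj (φ j)) (hΛlim.comp hφ.tendsto_atTop)
    (hslim.comp hφ.tendsto_atTop) (fun j => hode (φ j)) (fun j => hbd (φ j))
    (fun j => hmass (φ j)) htstar hlo (fun j => hfloor (φ j)) hcc hcont⟩
end WakeRatchetScalarFrontCompactness

end Summit.NavierStokesRegularity.NavierStokesRegularity.Theorems

end
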